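import Literature.Computability.Cryptography.SchemesProofs
import HarnessLib

/-!
# One-time signatures already imply one-way functions; the S23 equivalence one fact away

Companion to `Schemes.lean` / `SchemesProofs.lean` (crypto-foundations.S23). `SchemesProofs.lean`
discharges the easy converse of Rompel's theorem,
`OWFExist_of_secureSignaturesExist_holds : SecureSignaturesExist → OWFExist`, through a
*query-free* forger (`SigOWF.FParams.forger = ⟨OracleAlg.ofFun _, coins, 1⟩`). This file records
what that proof gives beyond S23, as printed in Goldreich's Exercise 13, and where the packaged
equivalence `secureSignaturesExist_iff_OWFExist` now stands:

* `oneTimeForgeProb_ofFun` — for a query-free one-round forger the one-time forging probability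
  (`oneTimeForgeProb`, runs with ≥ 2 signing queries count as failures) and the general one
  (`forgeProb`) coincide: its transcripts carry no query.
* `OWFExist_of_queryFree_unforgeable` — **an efficient, correct signature scheme that is
  unforgeable by query-free PPT forgers already yields a one-way function** (Goldreich 2004, §6.6,
  Exercise 13, the "furthermore" clause: "this holds even for … schemes that are secure (only)
  under attacks that make no signing-queries"); the proof is the assembly of
  `OWFExist_of_secureSignaturesExist_holds` run with the weaker hypothesis.
* `OWFExist_of_exists_isOneTimeSecure` — **secure one-time signature schemes imply one-way
  functions** (Goldreich 2004, §6.6, Exercise 13; "Note that even the existence of secure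
  1-restricted one-time signature schemes implies the existence of one-way functions", §6.4.1.1).
* Frontier glue for **S23**: with the converse discharged, the equivalence
  `secureSignaturesExist_iff_OWFExist` rests on the single named fact
  `secureSignaturesExist_of_OWFExist` (Rompel 1990, Thm. 3; Goldreich 2004, Thm. 6.4.1, hard
  direction) — `secureSignaturesExist_iff_OWFExist_of_rompel`; under that fact the existence of
  EUF-CMA-secure schemes, of secure one-time schemes and of one-way functions are all equivalent
  (`exists_isOneTimeSecure_iff_OWFExist_of_rompel`,
  `secureSignaturesExist_iff_exists_isOneTimeSecure_of_rompel`).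

No statement of `Schemes.lean` is changed and no named fact is introduced.

## References

* O. Goldreich, *Foundations of Cryptography II: Basic Applications*, CUP 2004, §6.4.1.1
  (Def. 6.4.2 and the remark after Def. 6.4.3), Thm. 6.4.1, §6.6 Exercises 5 (Part 2, guideline)
  and 13.
* J. Rompel, *One-way functions are necessary and sufficient for secure signatures*, STOC 1990,
  Lemma 1 and Thm. 3.
* R. Impagliazzo, M. Luby, *One-way functions are essential for complexity based cryptography*,
  FOCS 1989, Thm. 1.
-/

namespace Literature.Computability.Cryptography

open Filter Asymptotics _root_.Computability Complexity Finset Polynomial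
open Complexity.Plumb Complexity.Brick Complexity.OracleCompose

/-! ### Query-free forgers: one-time and general forging probabilities agree -/

/-- Every outcome of the chosen-message-attack experiment against a query-free one-round forger
`⟨OracleAlg.ofFun F, coins, 1⟩` has an empty query transcript. [Goldreich 2004, Def. 6.1.2 and
§6.1.3] [folklore] -/
theorem queries_eq_nil_of_mem_support_cmaExpPMF_ofFun (S : SignatureScheme)
    (F : List Bool → List Bool × List Bool) (coins : Polynomial ℕ) (n : ℕ)
    {t : List Bool × List (List Bool) × Option (List Bool × List Bool)}
    (ht : t ∈ (S.cmaExpPMF ⟨OracleAlg.ofFun F, coins, 1⟩ n).support) : t.2.1 = [] := by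
  rw [SignatureScheme.cmaExpPMF] at ht
  obtain ⟨ks, -, ht⟩ := (PMF.mem_support_bind_iff _ _ _).1 ht
  rw [SigOWF.probTranscriptPMF_ofFun] at ht
  obtain ⟨t', ht', rfl⟩ := (PMF.mem_support_map_iff _ _ _).1 ht
  obtain ⟨r, -, rfl⟩ := (PMF.mem_support_map_iff _ _ _).1 ht'
  rfl

/-- **For a query-free one-round forger the one-time forging probability equals the forging
probability**: on the support of the experiment no signing query is recorded, so the one-time
forgery event (a forgery after at most one query) and the forgery event have the same mass.
[Goldreich 2004, Def. 6.4.2 (attacks "that make at most one query") with §6.6 Exercise 13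
("attacks that make no signing-queries")] [cite: Goldreich2004, Def. 6.4.2 and §6.6 Exercise 13] -/
theorem oneTimeForgeProb_ofFun (S : SignatureScheme) (F : List Bool → List Bool × List Bool)
    (coins : Polynomial ℕ) (n : ℕ) :
    oneTimeForgeProb S ⟨OracleAlg.ofFun F, coins, 1⟩ n = forgeProb S ⟨OracleAlg.ofFun F, coins, 1⟩ n := by
  unfold oneTimeForgeProb forgeProb
  congr 1
  rw [← PMF.toOuterMeasure_apply_inter_support,
    ← PMF.toOuterMeasure_apply_inter_support _ S.forgeEvent]
  congr 1
  ext t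
  simp only [Set.mem_inter_iff, SignatureScheme.oneTimeForgeEvent, SignatureScheme.forgeEvent,
    Set.mem_setOf_eq]
  constructor
  · rintro ⟨⟨h1, -⟩, h2⟩
    exact ⟨h1, h2⟩
  · rintro ⟨h1, h2⟩
    refine ⟨⟨h1, ?_⟩, h2⟩
    rw [queries_eq_nil_of_mem_support_cmaExpPMF_ofFun S F coins n h2]
    exact Nat.zero_le _

/-! ### One-way functions from unforgeability against query-free forgers -/

open SigOWF in
/-- **Query-free unforgeability already gives a one-way function** (Goldreich 2004, §6.6,
Exercise 13, "furthermore" clause: "prove that this holds even for 1-restricted signature schemes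
that are secure (only) under attacks that make no signing-queries"; guideline: "See guideline for
Item 2 in Exercise 5", i.e. `f(1ⁿ, r) = v` where `G(1ⁿ; r) = (·, v)`). If `(G, S, V)` is efficient
and correct and every *query-free* PPT forger `⟨OracleAlg.ofFun F, coins, 1⟩` forges only with
negligible probability, then one-way functions exist: the one-way function is `SigOWF.Ctx.f` of
`SchemesProofs.lean`, a PPT inverter `A` yields the query-free PPT forger `SigOWF.FParams.forger`
whose forging probability dominates the inversion probability on every block of input lengths
(`SigOWF.FParams.invertProb_le_forgeProb`), and negligibility transfers back
(`SigOWF.superpolynomialDecay_of_dominated`). The script is the assembly of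
`OWFExist_of_secureSignaturesExist_holds` run with this weaker hypothesis.
[Goldreich 2004, §6.6 Exercise 13 with Exercise 5 (Part 2, guideline); Impagliazzo–Luby 1989,
Thm. 1; Rompel 1990, Lemma 1] [cite: Goldreich2004, §6.6 Exercise 13] -/
theorem OWFExist_of_queryFree_unforgeable (S : SignatureScheme) (heff : S.IsEfficient)
    (hcorr : S.IsCorrect)
    (hunf : ∀ (F : List Bool → List Bool × List Bool) (coins : Polynomial ℕ),
      (⟨OracleAlg.ofFun F, coins, 1⟩ : OracleAdversary (List Bool × List Bool)).IsPPT
          ((encodingList Bool).pairBool (encodingList Bool)) →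
        SuperpolynomialDecay atTop (fun n : ℕ => (n : ℝ)) (forgeProb S ⟨OracleAlg.ofFun F, coins, 1⟩)) :
    OWFExist := by
  obtain ⟨⟨hKm, cK, hcK⟩, ⟨hSm, cS, hcS⟩, hV⟩ := heff
  set P : Ctx := ⟨S, cK⟩ with hP
  refine ⟨P.f, Ctx.f_mem_FP (P := P) hKm, fun A hA => ?_⟩
  -- the machines and their output bounds
  have hkg : kgFn P ∈ FP := kgFn_mem_FP hKm
  have hsg : signFn P ∈ FP := signFn_mem_FP hSm
  have hv : verFn P ∈ FP := verFn_mem_FP hV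
  have ha : aFn A ∈ FP := aFn_mem_FP hA
  obtain ⟨cA, hcA⟩ := hA.2
  obtain ⟨oK, hoK⟩ := exists_poly_length_le_of_mem_FP hkg
  obtain ⟨oSg, hoSg⟩ := exists_poly_length_le_of_mem_FP hsg
  -- the polynomials of the forger
  set cap : Polynomial ℕ := oK.comp (C 2 * X + C 2 + P.Wpoly) with hcap
  set LA : Polynomial ℕ := cA.comp (C 4 * P.Bpoly.comp (X + 1) + C 4 + P.Wpoly * (C 2 * cap + C 2))
    with hLA
  set LS : Polynomial ℕ := cS.comp (C 2 * cap + C 2) with hLS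
  set oS : Polynomial ℕ := oSg.comp (C 4 * cap + C 6 + LS) with hoS
  set R : Polynomial ℕ := P.Wpoly * (LA + 1) * (LS + 1) * P.Bpoly.comp (X + 1) with hR
  set coins : Polynomial ℕ := P.Bpoly + LA + LS with hcoins
  set Q : FParams := ⟨P, cap, LA, LS, oS, R⟩ with hQ
  -- the hypotheses of the domination lemma, at every `n`
  have hcoinK : ∀ n, S.keyGen.coinLen n < P.W n := fun n => (hcK n).trans_lt (P.cK_lt_W n)
  have hcapK : ∀ (n : ℕ) (c : List Bool), c.length ≤ P.W n →
      (pairCode (S.keyGen.run n c)).length ≤ cap.eval n := by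
    intro n c hc
    have h1 := hoK (boolPair (ones n) c)
    rw [kgFn_boolPair, List.length_replicate, length_boolPair, List.length_replicate] at h1
    refine h1.trans ?_
    rw [hcap]
    simp only [eval_comp, eval_add, eval_mul, eval_C, eval_X, Ctx.eval_Wpoly]
    exact natPoly_eval_mono oK (by omega)
  have hcoinA : ∀ n m, m ≤ 4 * P.B (n + 1) + 4 + P.W n * (2 * cap.eval n + 2) →
      A.coinLen m ≤ LA.eval n := by
    intro n m hm
    refine (hcA m).trans ?_
    rw [hLA]
    simp only [eval_comp, eval_add, eval_mul, eval_C, eval_X, eval_one, Ctx.eval_Wpoly,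
      Ctx.eval_Bpoly]
    exact natPoly_eval_mono cA hm
  have hcoinS : ∀ n m, m ≤ 2 * cap.eval n + 2 → S.sign.coinLen m ≤ LS.eval n := by
    intro n m hm
    refine (hcS m).trans ?_
    rw [hLS]
    simp only [eval_comp, eval_add, eval_mul, eval_C]
    exact natPoly_eval_mono cS hm
  have houtS : ∀ (n : ℕ) (sk ρ : List Bool), sk.length ≤ cap.eval n → ρ.length ≤ LS.eval n →
      (S.sign.run (sk, []) ρ).length ≤ oS.eval n := by
    intro n sk ρ hsk hρ
    have h1 := hoSg (boolPair (boolPair sk []) ρ)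
    rw [signFn_boolPair, length_boolPair, length_boolPair, List.length_nil] at h1
    refine h1.trans ?_
    rw [hoS]
    simp only [eval_comp, eval_add, eval_mul, eval_C]
    exact natPoly_eval_mono oSg (by omega)
  have hRle : ∀ n, P.W n * (LA.eval n + 1) * (LS.eval n + 1) * (P.B (n + 1) - P.B n) ≤ R.eval n := by
    intro n
    rw [hR]
    simp only [eval_mul, eval_add, eval_one, eval_comp, eval_X, Ctx.eval_Wpoly, Ctx.eval_Bpoly]
    exact Nat.mul_le_mul_left _ (Nat.sub_le _ _)
  have hcoinsle : ∀ n, P.B n + LA.eval n + LS.eval n ≤ coins.eval n := by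
    intro n
    rw [hcoins]
    simp only [eval_add, Ctx.eval_Bpoly, le_refl]
  -- the query-free forger and its negligible forging probability
  have hPPT : (Q.forger A coins).IsPPT ((encodingList Bool).pairBool (encodingList Bool)) :=
    FParams.forger_isPPT hkg hsg hv ha coins
  have hnegl : SuperpolynomialDecay atTop (fun n : ℕ => (n : ℝ)) (forgeProb S (Q.forger A coins)) :=
    hunf (Q.fOut A) coins hPPT
  -- domination on every block, then transfer
  have hdom : ∀ᶠ N in atTop, invertProb P.f A N ≤ forgeProb S (Q.forger A coins) (P.nOf N) := by
    filter_upwards [eventually_ge_atTop (P.B 0)] with N hN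
    exact FParams.invertProb_le_forgeProb (Q := Q) hcorr (P.B_nOf_le hN) (P.lt_B_nOf_succ N)
      (hcoinK _) (hcapK _) (hcoinA _) (hcoinS _) (houtS _) (hRle _) (hcoinsle _)
  refine superpolynomialDecay_of_dominated (P.Bpoly.comp (X + 1)) hnegl (invertProb_nonneg P.f A)
    hdom P.tendsto_nOf (Eventually.of_forall fun N => ?_)
  simp only [eval_comp, eval_add, eval_X, eval_one, Ctx.eval_Bpoly]
  exact (P.lt_B_nOf_succ N).le

/-- **Secure one-time signature schemes imply one-way functions** (Goldreich 2004, §6.6,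
Exercise 13: "prove that the existence of secure one-time signature schemes implies the existence
of one-way functions"; also the remark of §6.4.1.1, "even the existence of secure 1-restricted
one-time signature schemes implies the existence of one-way functions"). A one-time secure scheme
(`SignatureScheme.IsOneTimeSecure`, Def. 6.4.2) is efficient, correct, and in particular
unforgeable by query-free PPT forgers, for which `oneTimeForgeProb = forgeProb`
(`oneTimeForgeProb_ofFun`); conclude by `OWFExist_of_queryFree_unforgeable`.
[Goldreich 2004, §6.6 Exercise 13; Def. 6.4.2] [cite: Goldreich2004, §6.6 Exercise 13] -/
theorem OWFExist_of_exists_isOneTimeSecure (h : ∃ S : SignatureScheme, S.IsOneTimeSecure) :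
    OWFExist := by
  obtain ⟨S, heff, hcorr, hunf⟩ := h
  refine OWFExist_of_queryFree_unforgeable S heff hcorr fun F coins hPPT => ?_
  have h1 := hunf ⟨OracleAlg.ofFun F, coins, 1⟩ hPPT
  have h2 : oneTimeForgeProb S ⟨OracleAlg.ofFun F, coins, 1⟩ = forgeProb S ⟨OracleAlg.ofFun F, coins, 1⟩ :=
    funext (oneTimeForgeProb_ofFun S F coins)
  rwa [h2] at h1

/-- One-way functions from secure one-time signatures, pointwise form: every one-time secure
scheme yields a one-way function. [Goldreich 2004, §6.6 Exercise 13] [cite: Goldreich2004, §6.6 Exercise 13] -/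
theorem SignatureScheme.IsOneTimeSecure.owfExist {S : SignatureScheme} (h : S.IsOneTimeSecure) :
    OWFExist :=
  OWFExist_of_exists_isOneTimeSecure ⟨S, h⟩

/-! ### Where the equivalence S23 stands: one named fact away -/

/-- **Frontier form of crypto-foundations.S23 (equivalence).** With the easy converse discharged
(`OWFExist_of_secureSignaturesExist_holds`, `SchemesProofs.lean`), the packaged equivalence
`secureSignaturesExist_iff_OWFExist` ("secure signature schemes exist if and only if one-way
functions exist") follows from the single remaining named fact
`secureSignaturesExist_of_OWFExist` — Rompel's theorem in the uniform model (one-way functions ⇒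
signature schemes secure against existential forgery under adaptive chosen-message attack by
polynomial-time algorithms), the hard direction of Goldreich's Thm. 6.4.1.
[Rompel 1990, Lemma 1 and Thm. 3; Goldreich 2004, Thm. 6.4.1] [cite: Rompel1990, Lemma 1 and Thm. 3] -/
theorem secureSignaturesExist_iff_OWFExist_of_rompel (h : secureSignaturesExist_of_OWFExist) :
    secureSignaturesExist_iff_OWFExist :=
  secureSignaturesExist_iff_OWFExist_of OWFExist_of_secureSignaturesExist_holds h

/-- Under Rompel's theorem (`secureSignaturesExist_of_OWFExist`), secure one-time signature
schemes exist if and only if one-way functions exist: `→` is Exercise 13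
(`OWFExist_of_exists_isOneTimeSecure`), `←` goes through EUF-CMA-secure schemes, which are in
particular one-time secure (`SignatureScheme.IsEUFCMA.isOneTimeSecure`).
[Goldreich 2004, Thm. 6.4.1, §6.4.1.1 and §6.6 Exercise 13; Rompel 1990, Thm. 3] [cite: Goldreich2004, Thm. 6.4.1 and §6.6 Exercise 13] -/
theorem exists_isOneTimeSecure_iff_OWFExist_of_rompel (h : secureSignaturesExist_of_OWFExist) :
    (∃ S : SignatureScheme, S.IsOneTimeSecure) ↔ OWFExist :=
  ⟨OWFExist_of_exists_isOneTimeSecure, exists_isOneTimeSecure_of_OWFExist_of h⟩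

/-- Under Rompel's theorem (`secureSignaturesExist_of_OWFExist`), EUF-CMA-secure signature schemes
exist if and only if secure one-time signature schemes exist (one-time schemes ⇒ one-way
functions ⇒ EUF-CMA-secure schemes ⇒ one-time schemes). [Goldreich 2004, Thm. 6.4.1, Thm. 6.4.9
and §6.6 Exercise 13; Rompel 1990, Thm. 3] [cite: Goldreich2004, Thm. 6.4.1 and §6.6 Exercise 13] -/
theorem secureSignaturesExist_iff_exists_isOneTimeSecure_of_rompel
    (h : secureSignaturesExist_of_OWFExist) :
    SecureSignaturesExist ↔ ∃ S : SignatureScheme, S.IsOneTimeSecure :=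
  ⟨exists_isOneTimeSecure_of_secureSignaturesExist,
    fun h₁ => h (OWFExist_of_exists_isOneTimeSecure h₁)⟩

/-- The hypothesis `h₂ : (∃ S, S.IsOneTimeSecure) → SecureSignaturesExist` of the printed assembly
`secureSignaturesExist_of_OWFExist_of_oneTimeSecure` (Goldreich's Thm. 6.4.9, one-time ⇒ general
signature schemes) is, by Exercise 13, already as strong as Rompel's theorem itself: it yields
`secureSignaturesExist_of_OWFExist` as soon as one-way functions give one-time schemes (`h₁`,
Thm. 6.4.29 with Thm. 6.4.32), and conversely Rompel's theorem gives `h₂` outright.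
[Goldreich 2004, §6.4.2.4 ("Theorem 6.4.9 follows by combining Proposition 6.4.17 with the fact
that the existence of secure one-time signature schemes implies the existence of one-way functions
(see Exercise 13)") and §6.4.3.4] [cite: Goldreich2004, §6.4.2.4 and §6.4.3.4] -/
theorem secureSignaturesExist_of_exists_isOneTimeSecure_of_rompel
    (h : secureSignaturesExist_of_OWFExist) :
    (∃ S : SignatureScheme, S.IsOneTimeSecure) → SecureSignaturesExist :=
  fun h₁ => h (OWFExist_of_exists_isOneTimeSecure h₁)

end Literature.Computability.Cryptography
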